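import Literature.NumberTheory.EllipticCurves.PAdicLFunctionIntegralityProofs
import HarnessLib

/-!
# BSD rank-≤1 residual cell: the Eisenstein multiple `(a_ℓ − ℓ − 1){∞, r}_f ∈ Λ_f` at EVERY cusp,
# for a prime `ℓ ≡ 1 (mod N)` (Drinfeld's operator `T_ℓ − ℓ − 1` fixes every cusp of `X₀(N)`)

HONEST FRAMING (cell `b2b-bsdres-*`, run/shared/lean/b2b/bsd-rank1-residual/, verbatim): the goal
of the cell is to DELETE the COMBINATION-SHAPED residual classes for ALL analytic-rank `≤ 1` elliptic
curves over `ℚ` — "full BSD formula for every rank `≤ 1` curve in class C" assembled STRICTLY from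
published theorems — so that the rank-`≤ 1` remainder becomes exactly the CONSTRUCTION-SHAPED
classes, which are TYPED (missing-input Props), NOT attempted; this is not "finishing BSD".
Prove what is provable now; shrink each hard class to its core with data; no claim beyond stated
classes.  Research routes; census output = EVIDENCE, never a Literature fact.  Unit
`b2b-bsdres-n1011-p09` (team n1011, ROUTE-1 sub-target R1-8 (ii), OWNERS row **T-R18b**, steps
S-C1/S-C2 of `cells/n1011/skel/T-R18b.md`).  THEOREMS ONLY (no definition, no named fact, no
instance); a TOOL file about modular symbols of weight-2 cusp forms on `Γ₀(N)` — no closure value,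
no class theorem, no label moves.

## What this file does

For `f ∈ S₂(Γ₀(N))` and a prime `ℓ` with `N ∣ ℓ − 1`:
1. (`modularSymbol_mul_div_sub_mem_periodLattice`, `modularSymbol_div_mul_sub_mem_periodLattice`)
   for `ℓ = 1 + Nq` two explicit matrices `γ ∈ Γ₀(N)` with `γ(a/c) = ℓa/c` (when `gcd(ℓa, c) = 1`),
   resp. `γ(a/c) = a/(ℓc)` (when `gcd(a, ℓc) = 1`), so these cusps are `Γ₀(N)`-equivalent and the
   symbols differ by a period — by the tree's PROVED Manin relation `modularSymbol_gamma0_smul_holds`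
   and `cuspSymbol_mem_periodLattice` (pattern of `modularSymbol_div_sub_zero_mem_periodLattice`);
2. (`modularSymbol_div_sub_mem_periodLattice_of_one_mod`) hence for EVERY `s ∈ ℚ`:
   `{∞, s/ℓ}_f − {∞, s}_f ∈ Λ_f` — "`T_ℓ` fixes every cusp of `X₀(N)` when `ℓ ≡ 1 (mod N)`"
   (Drinfeld 1973; Manin 1972 §3) — and `{∞, (r+j)/ℓ} − {∞, r}`, `{∞, ℓr} − {∞, r} ∈ Λ_f`;
3. (`sub_mul_modularSymbol_mem_periodLattice_of_one_mod`) for a NEWFORM `f`, the PROVED Hecke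
   relation `a_ℓ{∞,r} = Σ_{j mod ℓ} {∞,(r+j)/ℓ} + {∞, ℓr}` (`cuspCoeff_mul_modularSymbol`, MTT (4.2),
   any `r`) gives the **Eisenstein multiple `(a_ℓ − ℓ − 1){∞, r}_f ∈ Λ_f` at EVERY cusp `r`** (the
   tree's `sub_mul_modularSymbol_zero_mem_periodLattice` is the cusp `0`, where `ℓ ≡ 1 (N)` is not
   needed).
Consumer: `Additive/PlusSymbolIntegrality.lean` (`p`-integrality of every `[r]⁺_f` when `E[p]` is
irreducible and `p` is odd, ROUTE-1 R1-8 (ii)).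

## References

* V. G. Drinfeld, *Two theorems on modular curves*, Funct. Anal. Appl. 7 (1973) 155–156;
  Ju. I. Manin, *Parabolic points and zeta functions of modular curves*, Izv. 36 (1972), Prop. 1.4,
  Thm. 1.6, §3, Cor. 3.6. [Manin1972]
* B. Mazur, J. Tate, J. Teitelbaum, Invent. Math. 84 (1986), §I.4 (4.2). [MazurTateTeitelbaum1986Invent]
* J. E. Cremona, *Algorithms for modular elliptic curves* (1997), §2.2, §2.8 (2.8.8). [CremonaAlgorithms1997]
* Cell files: `cells/n1011/skel/T-R18b.md` S-C; `cells/n1011/ROUTE-1.md` §15.1 F-d v2, §15.4 R1-8.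
-/

noncomputable section

open scoped MatrixGroups ModularForm

open CongruenceSubgroup Literature.NumberTheory.EllipticCurves.ModularForms
  Literature.NumberTheory.EllipticCurves

namespace Summit.BirchSwinnertonDyer.Rank1Residual.Additive

/-! ### Cusps `a/c`, `ℓa/c`, `a/(ℓc)` are `Γ₀(N)`-equivalent when `ℓ ≡ 1 (mod N)` -/

section CuspClasses

variable {N : ℕ} [NeZero N] (f : CuspForm (Gamma0 N) 2)

/-- **`{∞, ℓa/c}_f ≡ {∞, a/c}_f (mod Λ_f)` for `ℓ = 1 + Nq` and `gcd(ℓa, c) = 1`** (witnessed by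
`tℓa + sc = q`): the matrix `γ = (1 + Ntℓa, aNs; cNt, 1 − aNt)` lies in `Γ₀(N)` (`det γ = 1 + Nta
(ℓ − 1 − N(tℓa + sc)) = 1`) and `γ(a/c) = ℓa/c` (denominator `cNt·a/c + 1 − aNt = 1`), so Manin's
relation `{∞, γ r} = {∞, γ∞} + {∞, r}` (`modularSymbol_gamma0_smul_holds`) exhibits the difference as
a period. [folklore] -/
theorem modularSymbol_mul_div_sub_mem_periodLattice {ℓ q a c t s : ℤ} (hc : c ≠ 0)
    (hℓ : ℓ = 1 + N * q) (hts : t * ℓ * a + s * c = q) :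
    modularSymbol f ((ℓ * a : ℚ) / c) - modularSymbol f ((a : ℚ) / c) ∈ periodLattice f := by
  let γ : SL(2, ℤ) := ⟨!![1 + N * t * ℓ * a, a * N * s; c * N * t, 1 - a * N * t], by
    rw [Matrix.det_fin_two_of]
    have : ℓ - 1 - N * (t * ℓ * a + s * c) = 0 := by rw [hts, hℓ]; ring
    linear_combination (N * t * a) * this⟩
  have hγ0 : γ ∈ Gamma0 N := by
    rw [Gamma0_mem]
    show (((c * N * t : ℤ)) : ZMod N) = 0
    push_cast
    rw [ZMod.natCast_self, mul_zero, zero_mul]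
  have hcQ : (c : ℚ) ≠ 0 := by exact_mod_cast hc
  have hq : (t : ℚ) * ℓ * a + s * c = q := by exact_mod_cast hts
  have hℓ' : (ℓ : ℚ) = 1 + N * q := by exact_mod_cast hℓ
  have hden : ((γ 1 0 : ℤ) : ℚ) * ((a : ℚ) / c) + ((γ 1 1 : ℤ) : ℚ) = 1 := by
    show ((c * N * t : ℤ) : ℚ) * ((a : ℚ) / c) + ((1 - a * N * t : ℤ) : ℚ) = 1
    rw [mul_div_assoc', div_add' _ _ _ hcQ, div_eq_iff hcQ]
    push_cast
    ring
  have hne : ((γ 1 0 : ℤ) : ℚ) * ((a : ℚ) / c) + ((γ 1 1 : ℤ) : ℚ) ≠ 0 := by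
    rw [hden]; exact one_ne_zero
  have key := modularSymbol_gamma0_smul_holds f ⟨γ, hγ0⟩ ((a : ℚ) / c) hne
  have hnum : ((γ 0 0 : ℤ) : ℚ) * ((a : ℚ) / c) + ((γ 0 1 : ℤ) : ℚ) = (ℓ * a : ℚ) / c := by
    show ((1 + N * t * ℓ * a : ℤ) : ℚ) * ((a : ℚ) / c) + ((a * N * s : ℤ) : ℚ) = (ℓ * a : ℚ) / c
    rw [mul_div_assoc', div_add' _ _ _ hcQ, div_left_inj' hcQ]
    push_cast
    linear_combination (a * N : ℚ) * hq + (-(a : ℚ)) * hℓ'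
  have hquot : (((γ 0 0 : ℤ) : ℚ) * ((a : ℚ) / c) + ((γ 0 1 : ℤ) : ℚ)) /
      (((γ 1 0 : ℤ) : ℚ) * ((a : ℚ) / c) + ((γ 1 1 : ℤ) : ℚ)) = (ℓ * a : ℚ) / c := by
    rw [hden, div_one, hnum]
  rw [hquot] at key
  rw [key, add_sub_cancel_right]
  exact cuspSymbol_mem_periodLattice f _

/-- **`{∞, a/(ℓc)}_f ≡ {∞, a/c}_f (mod Λ_f)` for `ℓ = 1 + Nq ≠ 0` and `gcd(a, ℓc) = 1`**
(witnessed by `ta + sℓc = q`): the matrix `γ = (1 − Nsc, aNs; Nct, 1 + Nsℓc)` lies in `Γ₀(N)`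
(`det γ = 1 + Nsc(ℓ − 1 − N(ta + sℓc)) = 1`) and `γ(a/c) = a/(ℓc)` (numerator `a/c`, denominator
`Nta + 1 + Nsℓc = ℓ`). [folklore] -/
theorem modularSymbol_div_mul_sub_mem_periodLattice {ℓ q a c t s : ℤ} (hc : c ≠ 0) (hℓ0 : ℓ ≠ 0)
    (hℓ : ℓ = 1 + N * q) (hts : t * a + s * ℓ * c = q) :
    modularSymbol f ((a : ℚ) / (ℓ * c)) - modularSymbol f ((a : ℚ) / c) ∈ periodLattice f := by
  let γ : SL(2, ℤ) := ⟨!![1 - N * s * c, a * N * s; N * c * t, 1 + N * s * ℓ * c], by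
    rw [Matrix.det_fin_two_of]
    have : ℓ - 1 - N * (t * a + s * ℓ * c) = 0 := by rw [hts, hℓ]; ring
    linear_combination (N * s * c) * this⟩
  have hγ0 : γ ∈ Gamma0 N := by
    rw [Gamma0_mem]
    show (((N * c * t : ℤ)) : ZMod N) = 0
    push_cast
    rw [ZMod.natCast_self, zero_mul, zero_mul]
  have hcQ : (c : ℚ) ≠ 0 := by exact_mod_cast hc
  have hℓQ : (ℓ : ℚ) ≠ 0 := by exact_mod_cast hℓ0
  have hq : (t : ℚ) * a + s * ℓ * c = q := by exact_mod_cast hts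
  have hℓ' : (ℓ : ℚ) = 1 + N * q := by exact_mod_cast hℓ
  have hden : ((γ 1 0 : ℤ) : ℚ) * ((a : ℚ) / c) + ((γ 1 1 : ℤ) : ℚ) = ℓ := by
    show ((N * c * t : ℤ) : ℚ) * ((a : ℚ) / c) + ((1 + N * s * ℓ * c : ℤ) : ℚ) = ℓ
    rw [mul_div_assoc', div_add' _ _ _ hcQ, div_eq_iff hcQ]
    push_cast
    linear_combination (N * c : ℚ) * hq + (-(c : ℚ)) * hℓ'
  have hne : ((γ 1 0 : ℤ) : ℚ) * ((a : ℚ) / c) + ((γ 1 1 : ℤ) : ℚ) ≠ 0 := by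
    rw [hden]; exact hℓQ
  have key := modularSymbol_gamma0_smul_holds f ⟨γ, hγ0⟩ ((a : ℚ) / c) hne
  have hnum : ((γ 0 0 : ℤ) : ℚ) * ((a : ℚ) / c) + ((γ 0 1 : ℤ) : ℚ) = (a : ℚ) / c := by
    show ((1 - N * s * c : ℤ) : ℚ) * ((a : ℚ) / c) + ((a * N * s : ℤ) : ℚ) = (a : ℚ) / c
    rw [mul_div_assoc', div_add' _ _ _ hcQ, div_left_inj' hcQ]
    push_cast
    ring
  have hquot : (((γ 0 0 : ℤ) : ℚ) * ((a : ℚ) / c) + ((γ 0 1 : ℤ) : ℚ)) /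
      (((γ 1 0 : ℤ) : ℚ) * ((a : ℚ) / c) + ((γ 1 1 : ℤ) : ℚ)) = (a : ℚ) / (ℓ * c) := by
    rw [hden, hnum, div_div, mul_comm]
  rw [hquot] at key
  rw [key, add_sub_cancel_right]
  exact cuspSymbol_mem_periodLattice f _

/-- **`T_ℓ` fixes every cusp of `X₀(N)` when `ℓ ≡ 1 (mod N)`**: for a prime `ℓ` with `N ∣ ℓ − 1`
and EVERY `s ∈ ℚ`, `{∞, s/ℓ}_f − {∞, s}_f ∈ Λ_f`.  Write `s = a/c` in lowest terms and
`ℓ − 1 = Nq`; if `ℓ ∣ a` use `modularSymbol_mul_div_sub_mem_periodLattice` for `a/ℓ` (Bezout for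
`gcd(a, c) = 1`), otherwise `modularSymbol_div_mul_sub_mem_periodLattice` (Bezout for
`gcd(a, ℓc) = 1`).  (Drinfeld 1973; Manin 1972, §3.) [folklore] -/
theorem modularSymbol_div_sub_mem_periodLattice_of_one_mod {ℓ : ℕ} (hℓ : ℓ.Prime)
    (hN : N ∣ ℓ - 1) (s : ℚ) :
    modularSymbol f (s / ℓ) - modularSymbol f s ∈ periodLattice f := by
  obtain ⟨q, hq⟩ := hN
  have hℓ1 : (ℓ : ℤ) = 1 + N * q := by
    have h1 : 1 ≤ ℓ := hℓ.one_le
    zify [h1] at hq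
    linarith
  have hℓ0 : (ℓ : ℤ) ≠ 0 := by exact_mod_cast hℓ.ne_zero
  -- `s = a / c` in lowest terms
  set a : ℤ := s.num with ha
  set c : ℤ := (s.den : ℤ) with hc
  have hc0 : c ≠ 0 := by rw [hc]; exact_mod_cast s.den_ne_zero
  have hs : s = (a : ℚ) / c := by rw [ha, hc]; push_cast; exact (Rat.num_div_den s).symm
  have hcop : IsCoprime a c := by
    rw [ha, hc, Int.isCoprime_iff_gcd_eq_one, Int.gcd, Int.natAbs_natCast]
    exact s.reduced
  by_cases hdvd : (ℓ : ℤ) ∣ a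
  · -- `a = ℓ a'`: `{∞, ℓa'/c} - {∞, a'/c} ∈ Λ_f`, and `s/ℓ = a'/c`
    obtain ⟨a', ha'⟩ := hdvd
    have hcop' : IsCoprime ((ℓ : ℤ) * a') c := by rwa [← ha']
    obtain ⟨u, v, huv⟩ := hcop'
    have h := modularSymbol_mul_div_sub_mem_periodLattice f (ℓ := ℓ) (q := q) (a := a') (c := c)
      (t := q * u) (s := q * v) hc0 hℓ1 (by linear_combination (q : ℤ) * huv)
    have h1 : ((ℓ : ℤ) * a' : ℚ) / c = s := by rw [hs, ha']; push_cast; ring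
    have h2 : ((a' : ℤ) : ℚ) / c = s / ℓ := by
      rw [hs, ha']
      have : (ℓ : ℚ) ≠ 0 := by exact_mod_cast hℓ.ne_zero
      push_cast
      field_simp
    push_cast at h1 h
    rw [h1, h2] at h
    have := (periodLattice f).neg_mem h
    rwa [neg_sub] at this
  · -- `ℓ ∤ a`: `gcd(a, ℓc) = 1` and `{∞, a/(ℓc)} - {∞, a/c} ∈ Λ_f`
    have hℓa : IsCoprime a (ℓ : ℤ) :=
      ((Nat.prime_iff_prime_int.mp hℓ).irreducible.coprime_iff_not_dvd.mpr hdvd).symm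
    have hcop' : IsCoprime a ((ℓ : ℤ) * c) := hℓa.mul_right hcop
    obtain ⟨u, v, huv⟩ := hcop'
    have h := modularSymbol_div_mul_sub_mem_periodLattice f (ℓ := ℓ) (q := q) (a := a) (c := c)
      (t := q * u) (s := q * v) hc0 hℓ0 hℓ1 (by linear_combination (q : ℤ) * huv)
    have h2 : ((a : ℤ) : ℚ) / ((ℓ : ℤ) * c) = s / ℓ := by
      rw [hs]; push_cast; rw [div_div, mul_comm]
    push_cast at h2 h
    rw [h2, ← hs] at h
    exact h

/-- For a prime `ℓ ≡ 1 (mod N)`, every `r` and every integer `j`: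
`{∞, (r + j)/ℓ}_f − {∞, r}_f ∈ Λ_f` (`{∞, r + j} = {∞, r}`, `modularSymbol_add_intCast_holds`).
[folklore] -/
theorem modularSymbol_add_div_sub_mem_periodLattice_of_one_mod {ℓ : ℕ} (hℓ : ℓ.Prime)
    (hN : N ∣ ℓ - 1) (r : ℚ) (j : ℤ) :
    modularSymbol f ((r + j) / ℓ) - modularSymbol f r ∈ periodLattice f := by
  have h := modularSymbol_div_sub_mem_periodLattice_of_one_mod f hℓ hN (r + j)
  rwa [modularSymbol_add_intCast_holds f r j] at h

/-- For a prime `ℓ ≡ 1 (mod N)` and every `r`: `{∞, ℓ r}_f − {∞, r}_f ∈ Λ_f` (apply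
`modularSymbol_div_sub_mem_periodLattice_of_one_mod` to `s = ℓ r`). [folklore] -/
theorem modularSymbol_mul_sub_mem_periodLattice_of_one_mod {ℓ : ℕ} (hℓ : ℓ.Prime)
    (hN : N ∣ ℓ - 1) (r : ℚ) :
    modularSymbol f (ℓ * r) - modularSymbol f r ∈ periodLattice f := by
  have h := modularSymbol_div_sub_mem_periodLattice_of_one_mod f hℓ hN (ℓ * r)
  have hℓ0 : (ℓ : ℚ) ≠ 0 := by exact_mod_cast hℓ.ne_zero
  rw [mul_div_cancel_left₀ r hℓ0] at h
  have := (periodLattice f).neg_mem h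
  rwa [neg_sub] at this

omit [NeZero N] in
/-- A prime `ℓ` with `N ∣ ℓ − 1` does not divide `N` (else `ℓ ∣ ℓ − 1`). [folklore] -/
theorem not_dvd_of_dvd_sub_one {ℓ : ℕ} (hℓ : ℓ.Prime) (hN : N ∣ ℓ - 1) : ¬ ℓ ∣ N := by
  intro h
  have h1 : ℓ ∣ ℓ - 1 := dvd_trans h hN
  have h2 : 0 < ℓ - 1 := by have := hℓ.two_le; omega
  have h3 := Nat.le_of_dvd h2 h1
  omega

/-- **The Eisenstein multiple at EVERY cusp: `(a_ℓ − ℓ − 1){∞, r}_f ∈ Λ_f` for a newform `f` of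
level `N`, a prime `ℓ ≡ 1 (mod N)` and any `r ∈ ℚ`.**  The Hecke relation
`a_ℓ{∞, r} = Σ_{j mod ℓ} {∞, (r + j)/ℓ} + {∞, ℓr}` (`cuspCoeff_mul_modularSymbol`, PROVED in the tree,
MTT (4.2)) has all `ℓ + 1` cusps on the right `Γ₀(N)`-equivalent to `r`.  This is Drinfeld's
operator `T_ℓ − ℓ − 1` killing the cuspidal divisor `(r) − (∞)` (Drinfeld 1973; Manin 1972 Cor. 3.6),
kept integral. [folklore] -/
theorem sub_mul_modularSymbol_mem_periodLattice_of_one_mod {f : CuspForm (Gamma0 N) 2}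
    (hf : IsNewform0 f) {ℓ : ℕ} (hℓ : ℓ.Prime) (hN : N ∣ ℓ - 1) (r : ℚ) :
    (cuspCoeff f ℓ - ℓ - 1) * modularSymbol f r ∈ periodLattice f := by
  haveI : NeZero ℓ := ⟨hℓ.ne_zero⟩
  have hℓN : ¬ ℓ ∣ N := not_dvd_of_dvd_sub_one hℓ hN
  have hH := cuspCoeff_mul_modularSymbol (p := ℓ) hf hℓ hℓN r
  have hj : ∀ j : Fin ℓ, modularSymbol f ((r + j) / ℓ) - modularSymbol f r ∈ periodLattice f := by
    intro j
    have h := modularSymbol_add_div_sub_mem_periodLattice_of_one_mod f hℓ hN r ((j : ℕ) : ℤ)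
    push_cast at h
    exact h
  have hmem : ∑ j : Fin ℓ, (modularSymbol f ((r + j) / ℓ) - modularSymbol f r) +
      (modularSymbol f (ℓ * r) - modularSymbol f r) ∈ periodLattice f :=
    add_mem (sum_mem fun j _ ↦ hj j) (modularSymbol_mul_sub_mem_periodLattice_of_one_mod f hℓ hN r)
  have heq : ∑ j : Fin ℓ, (modularSymbol f ((r + j) / ℓ) - modularSymbol f r) +
      (modularSymbol f (ℓ * r) - modularSymbol f r) =
      (cuspCoeff f ℓ - ℓ - 1) * modularSymbol f r := by
    rw [Finset.sum_sub_distrib, Finset.sum_const, Finset.card_univ, Fintype.card_fin,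
      nsmul_eq_mul]
    linear_combination -hH
  rwa [heq] at hmem

end CuspClasses

end Summit.BirchSwinnertonDyer.Rank1Residual.Additive

end
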